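import Summits.Parity.GeneralizedHardyLittlewood.Theorems.LeeYangFibresRelativeDimOneNecessityDefs
import Summits.Parity.GeneralizedHardyLittlewood.Theorems.LeeYangFibresRelativeDimOneUpperAmplification
import Summits.Parity.GeneralizedHardyLittlewood.Theorems.LeeYangFibresRelativeDimOneLatticeNecessity
import Summits.Parity.GeneralizedHardyLittlewood.Theorems.LeeYangFibresRelativeDimOneCharacterNecessity
import HarnessLib

/-!
# Route `LeeYangFibres`, crux `RelativeDimOne` (stmt-Parity-14113): HARDNESS CERTIFICATES of the line
`SketchIdeator1` = `translate-amplification` and its atom (card `gallagher-backwards-split`)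

Pure composition of the cycle-2 certificates of the line lead (all kernel-checked in the tree):

* `upperRelativeDimOne_of_coarseUpperHLSlack : CoarseUpperHLSlack → UpperRelativeDimOne`
  (`…UpperAmplification.lean`, upper-half amplification over translate-constellations),
* `latticeNecessity : UpperRelativeDimOne → SharpClassSecondMoment` (`…LatticeNecessity.lean`, Gallagher's
  identity backwards + the exact lattice mean of the singular series + PNT),
* `characterNecessity : SharpClassSecondMoment → UniformCharPNT` (`…CharacterNecessity.lean`, orthogonality of
  characters + PNT for the principal character),

giving:

* **`uniformCharPNT_of_coarseUpperHLSlack : CoarseUpperHLSlack → UniformCharPNT`** (registered sub-goal) — ANY source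
  of coarse UPPER bounds `S(Φ, K) ≤ e^{g(T)} β_∞𝔖 + ηN` for prime constellations that is uniform over non-degenerate
  `T`-systems of size `‖Φ‖_N ≤ L` and loses only `g(T) = o(T)` in the number of forms proves the prime number
  theorem `ψ(N, χ) = o(N)` for EVERY non-principal Dirichlet character of conductor `q ≤ N^θ`, every `θ < 1`
  (in particular it bounds the quality of Siegel zeros): sub-exponential dimension dependence of
  prime-constellation upper bounds is `L`-function-hard;
* `uniformCharPNT_of_upperRelativeDimOne`, **`uniformCharPNT_of_relativeDimOne : RelativeDimOne → UniformCharPNT`**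
  — the crux itself (indeed its upper half) carries this `L`-function content;
* `uniformCharPNT_of_coarseHLSlack` — so does the line's atom (equivalent to the crux,
  `relativeDimOne_iff_coarseHLSlack`).

These sharpen the in-tree certificate `RelativeDimOne → TwinPrimeConjecture`
(`Theorems/LeeYangFibresRelativeDimOne.lean`) from "twin-prime-hard" to "GRH-lite-hard": every line for this
crux must contain, or imply, `o(N)` cancellation in `ψ(N,χ)` for all conductors `≤ N^{1−o(1)}`.
-/

noncomputable section

namespace Summit.Parity.GeneralizedHardyLittlewood.Cruxes.RelativeDimOne.GallagherBackwards

open Summit.Parity.GeneralizedHardyLittlewood.Theses.LeeYangFibres (RelativeDimOne)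

/-- **Coarse UPPER bounds for prime constellations with sub-exponential dimension loss are
`UniformCharPNT`-hard** (registered sub-goal of stmt-Parity-14113): upper-half amplification, then Gallagher's
identity backwards, then orthogonality of characters. -/
theorem uniformCharPNT_of_coarseUpperHLSlack : CoarseUpperHLSlack → UniformCharPNT :=
  fun h => characterNecessity (latticeNecessity (upperRelativeDimOne_of_coarseUpperHLSlack h))

/-- The upper half of the crux already forces uniform character PNT. -/
theorem uniformCharPNT_of_upperRelativeDimOne : UpperRelativeDimOne → UniformCharPNT :=
  fun h => characterNecessity (latticeNecessity h)

/-- **The crux `RelativeDimOne` forces uniform PNT for all Dirichlet characters of conductor `≤ N^θ`, `θ < 1`.** -/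
theorem uniformCharPNT_of_relativeDimOne : RelativeDimOne → UniformCharPNT :=
  fun h => uniformCharPNT_of_upperRelativeDimOne (upperRelativeDimOne_of_relativeDimOne h)

/-- So does the line's atom `CoarseHLSlack` (two-sided coarse bounds; only its upper half is used). -/
theorem uniformCharPNT_of_coarseHLSlack : TranslateAmplification.CoarseHLSlack → UniformCharPNT :=
  fun h => uniformCharPNT_of_coarseUpperHLSlack (coarseUpperHLSlack_of_coarseHLSlack h)

end Summit.Parity.GeneralizedHardyLittlewood.Cruxes.RelativeDimOne.GallagherBackwards
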